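import Summits.BirchSwinnertonDyer.BirchSwinnertonDyer.Theorems.CycTangentCMCycTangentBoundPowerLine
import Summits.BirchSwinnertonDyer.BirchSwinnertonDyer.Theorems.CycTangentCMCycTangentBoundSplitPrimeSaturation
import Literature.NumberTheory.GaloisRepresentations.PadicCharacterNthRoot
import HarnessLib

/-!
# Crux `CycTangentCM.CycTangentBound` (stmt-BirchSwinnertonDyer-22628), N-line assembly input (A1)/(A3):
# the lead's `Ψ`-POWER LINE of a two-variable frame READ ON THE SPLIT-PRIME `ℤ_p`-LINE — the frame
# prescribes the ONE-VARIABLE branch `G|_κ = monomialLine (κγ₁) (κγ₂) G` at the nodes `T = uⁿ − 1`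
# (`--supports 22628`; nothing is closed; BSD is not proved by any of this)

Seat `prover-bsd-line-ctcm-p3` (D-0145 line `route-BirchSwinnertonDyer-CycTangentCM`, prover 3/3).  The
lead's `CycTangentCMCycTangentBoundPowerLine.exists_powerLine_hasValueAt₂` reads a frame
`IsKatzMeasure₂ … κ₁ κ₂ γ₁ γ₂ λ …` at the two-variable nodes `(xⁿ − 1, yⁿ − 1)` of the avatars `e ∘ χⁿ`
of `Ψ^{−Mn}`.  With the SATURATION of the split-prime line (`exists_splitPrimeLine_factorsThroughZp`:
after a `p`-power in `M` these avatars factor through ONE `ℤ_p`-quotient `κ` through the pair,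
unramified at `v̄`) and `ZpExtension.avatarValueAt_eq_onePlusPow`, `(x, y) = ((1+ϖ)^{κγ₁}, (1+ϖ)^{κγ₂})`
with `1 + ϖ = u := χ^N(γ)` for a generator `γ` of `κ`, so by `IntSeries.hasValueAt_monomialLine_iff` the
SAME values are values of the one-variable branch `monomialLine (κγ₁) (κγ₂) G` at the geometric nodes
`uⁿ − 1` — exactly the node shape of the forward-difference certificate
(`IntSeries.isUnit_coeff_iff_norm_fwdDiff_values_eq`, nodes `u^t − 1`, `u ≠ 1`, `‖u − 1‖ < 1`) and of
the line kill criterion (`not_cycTangentBound_of_lineGap`).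

* `not_hasInfinityType_one_zero_of_ne_zero` — on a totally complex field the trivial Hecke character
  does not have type `(k, 0)`, `k ≠ 0` (evaluate at the infinite idele `2`).
* `exists_pow_norm_sub_one_lt_norm` — a continuous `χ : Γ_K → ℚ̄_pˣ` has a power `χ^N`, `N ≥ 1`, with
  ALL values in the one-units of level `|p|` (`‖χ(g)^N − 1‖ < ‖p‖`): the open subgroup
  `χ⁻¹(U_{|p|})` of the compact `Γ_K` has finite index.
* `exists_splitPrimeLine_powerLine` — **THE POWER LINE ON THE SPLIT-PRIME LINE.** For `K` imaginary
  quadratic, `p` odd and split (`v ≠ v̄`, `ι` normalised by `hι`), a generator pair, a frame `G` with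
  twist `λ` of type `(−a, 0)`, `a > 0`, unramified off `S`, and `Ψ` of type `(w, 0)`, `w > 0`,
  unramified everywhere: there are a `ℤ_p`-quotient `κ` THROUGH THE PAIR and UNRAMIFIED AT `v̄`, a
  generator `γ` of `κ`, `M > 0` and `u ∈ ℂ_p` with `u ≠ 1`, `‖u − 1‖ < ‖p‖`, such that for every `n`
  and every entire continuation of `L(λΨ^{−Mn}, s)`:
  `(monomialLine (κγ₁) (κγ₂) G)(uⁿ − 1) = ι⁻¹(interpolationValue … (λΨ^{−Mn}) (a + wMn) 0 …)·Ω_p^{a+wMn}`.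
  (`u ≠ 1`: otherwise `χ^N` is trivial on `κ`'s generator and on `ker κ`, hence trivial, so `Ψ^{−M}`
  has the avatar of `1` and IS `1` (`eq_of_isPAdicAvatarOf_of_isPAdicAvatarOf`), contradicting its type
  `(−wM, 0) ≠ (0, 0)`.)

Theorems only; nothing is closed; crux 22628 stays OPEN; BSD is not proved by any of this.
References: [deShalit1987] II.4.16 (49)–(50), II.4.17 (51)–(54); [Weil1956] §1; [Washington1997] §13.1.
-/

set_option linter.dupNamespace false
set_option autoImplicit false

noncomputable section

open scoped NumberField ComplexConjugate
open NumberField IsDedekindDomain Field NumberField.InfinitePlace NumberField.InfinitePlace.Completion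
open Literature Literature.NumberTheory.GaloisRepresentations Literature.NumberTheory.EllipticCurves
open Summit.BirchSwinnertonDyer.Rank1Residual.X11b
open Summit.BirchSwinnertonDyer.Rank1Residual.X11b.Three.LambdaSupply
open Summit.BirchSwinnertonDyer.Rank1Residual.X11b.LambdaSupply
open Summit.BirchSwinnertonDyer.BirchSwinnertonDyer.Theorems.CycTangentCMCycTangentBoundPairSupply

namespace Summit.BirchSwinnertonDyer.BirchSwinnertonDyer.Theorems.CycTangentCMCycTangentBoundSplitPrimePowerLine

variable {p : ℕ} [Fact p.Prime] {K : Type} [Field K] [NumberField K]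

/-! ### §1. The trivial character has no type `(k, 0)`, `k ≠ 0` -/

omit [Fact p.Prime] in
/-- **On a totally complex field the trivial Hecke character does not have infinity type `(k, 0)` with
`k ≠ 0`**: the type would give `1 = ∏_w ι_w(x_w)^{-k}` for every (automatically totally positive)
infinite idele `x` (`HasInfinityType.apply_infiniteIdeles_eq`); at the idele with all coordinates `2`
the right-hand side is `2^{-kc} ≠ 1` (`c ≥ 1` the number of infinite places). -/
theorem not_hasInfinityType_one_zero_of_ne_zero [IsTotallyComplex K] {k : ℤ} (hk : k ≠ 0) :
    ¬ (1 : HeckeCharacter K).HasInfinityType (fun _ ↦ k) (fun _ ↦ (0 : ℤ)) := by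
  classical
  intro h
  set c : ℕ := Fintype.card (InfinitePlace K) with hc_def
  have hc : 0 < c := Fintype.card_pos
  set z : ℂ := 2 with hz_def
  have hz0 : z ≠ 0 := by rw [hz_def]; exact two_ne_zero
  let ρ : ℂ →+* InfiniteAdeleRing K :=
    RingHom.pi fun w : InfinitePlace K =>
      ((ringEquivComplexOfIsComplex (IsTotallyComplex.isComplex w)).symm : ℂ ≃+* w.Completion).toRingHom
  let x : (InfiniteAdeleRing K)ˣ := Units.map (ρ : ℂ →* InfiniteAdeleRing K) (Units.mk0 z hz0)
  have hxw : ∀ w : InfinitePlace K, extensionEmbedding w ((x : InfiniteAdeleRing K) w) = z := by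
    intro w
    show extensionEmbedding w
      ((ringEquivComplexOfIsComplex (IsTotallyComplex.isComplex w)).symm z) = z
    rw [← ringEquivComplexOfIsComplex_apply (IsTotallyComplex.isComplex w), RingEquiv.apply_symm_apply]
  have hpos : InfiniteIdele.IsTotallyPositive x := fun w hw =>
    absurd hw (not_isReal_iff_isComplex.mpr (IsTotallyComplex.isComplex w))
  have key := h.apply_infiniteIdeles_eq hpos
  rw [HeckeCharacter.one_apply, Units.val_one, HeckeCharacter.archFactor_apply] at key
  simp_rw [hxw] at key
  rw [Finset.prod_const, Finset.card_univ, ← hc_def, neg_zero, zpow_zero, mul_one, ← zpow_natCast,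
    ← zpow_mul] at key
  -- `‖2^{-k c}‖ = 2^{-k c} ≠ 1`
  have hnorm : (2 : ℝ) ^ (-k * (c : ℤ)) = 1 := by
    have := congrArg (fun t : ℂ ↦ ‖t‖) key
    simp only [norm_one, norm_zpow, hz_def] at this
    rw [Complex.norm_ofNat] at this
    exact this.symm
  have hexp : -k * (c : ℤ) = 0 := by
    have h1 : (2 : ℝ) ^ (-k * (c : ℤ)) = (2 : ℝ) ^ (0 : ℤ) := by rw [hnorm, zpow_zero]
    exact zpow_right_injective₀ (by norm_num) (by norm_num) h1
  have : k * (c : ℤ) = 0 := by linarith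
  rcases mul_eq_zero.mp this with h0 | h0
  · exact hk h0
  · exact hc.ne' (by exact_mod_cast h0)

/-! ### §2. A power of a continuous character of `Γ_K` with values in the one-units of level `|p|` -/

/-- **Some power `χ^N` (`N ≥ 1`) of a continuous `χ : Γ_K → ℚ̄_pˣ` takes ALL its values in the one-units
of level `|p|`**: `‖χ(g)^N − 1‖ < ‖p‖` for every `g` — the one-units of level `‖p‖` form an open subgroup
`U` (`exists_subgroup_units_norm_sub_one_lt`), `χ⁻¹(U)` is open of finite index `N` in the compact
`Γ_K`, and `g^N ∈ χ⁻¹(U)`. -/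
theorem exists_pow_norm_sub_one_lt_norm (χ : absoluteGaloisGroup K →ₜ* (PadicAlgCl p)ˣ) :
    ∃ N : ℕ, 0 < N ∧ ∀ g : absoluteGaloisGroup K,
      ‖((χ g : (PadicAlgCl p)ˣ) : PadicAlgCl p) ^ N - 1‖ < ‖(p : PadicAlgCl p)‖ := by
  have hp : p.Prime := Fact.out
  have hr0 : 0 < ‖(p : PadicAlgCl p)‖ := by
    rw [PadicAlgCl.norm_natCast_self]; exact inv_pos.mpr (by exact_mod_cast hp.pos)
  have hr1 : ‖(p : PadicAlgCl p)‖ ≤ 1 := PadicAlgCl.norm_natCast_self_lt_one.le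
  obtain ⟨U, hU, hUopen⟩ := exists_subgroup_units_norm_sub_one_lt (L := PadicAlgCl p) hr0 hr1
  set H : Subgroup (absoluteGaloisGroup K) := U.comap χ.toMonoidHom with hH
  have hHopen : IsOpen (H : Set (absoluteGaloisGroup K)) := hUopen.preimage χ.continuous
  haveI : DiscreteTopology (absoluteGaloisGroup K ⧸ H) := QuotientGroup.discreteTopology hHopen
  haveI : Finite (absoluteGaloisGroup K ⧸ H) := finite_of_compact_of_discrete
  haveI : H.FiniteIndex := Subgroup.finiteIndex_of_finite_quotient
  refine ⟨H.index, Nat.pos_of_ne_zero Subgroup.FiniteIndex.index_ne_zero, fun g ↦ ?_⟩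
  have hmem : g ^ H.index ∈ H := Subgroup.pow_index_mem H g
  have := (hU _).mp (Subgroup.mem_comap.mp hmem)
  rwa [ContinuousMonoidHom.coe_toMonoidHom, map_pow, Units.val_pow_eq_pow_val] at this

omit [NumberField K] in
/-- `(1+x)^c` at `x = 0` is `1`. -/
theorem onePlusPow_zero (c : ℤ_[p]) : IntSeries.onePlusPow c (0 : ℂ_[p]) = 1 := by
  unfold IntSeries.onePlusPow
  rw [tsum_eq_single 0 (fun n hn ↦ by rw [zero_pow hn, mul_zero])]
  simp

omit [NumberField K] in
/-- `avatarValueAt (e ∘ ψ) σ = 1` forces `ψ σ = 1`. -/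
theorem unitsChar_apply_eq_one_of_avatarValueAt_eq_one {ψ : absoluteGaloisGroup K →ₜ* (PadicAlgCl p)ˣ}
    {σ : absoluteGaloisGroup K}
    (h : avatarValueAt ((FramedRep.unitsContinuousMulEquivOfUnique (Fin 1) (PadicAlgCl p) :
      (PadicAlgCl p)ˣ →ₜ* GL (Fin 1) (PadicAlgCl p)).comp ψ) σ = 1) : ψ σ = 1 := by
  rw [avatarValueAt_unitsChar, PadicComplex.coe_eq, ← map_one (algebraMap (PadicAlgCl p) ℂ_[p])] at h
  exact Units.ext ((algebraMap (PadicAlgCl p) ℂ_[p]).injective h)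

/-! ### §3. The power line on the split-prime line -/

/-- **THE `Ψ`-POWER LINE OF A TWO-VARIABLE FRAME, READ ON THE SPLIT-PRIME `ℤ_p`-LINE.**  For `K`
imaginary quadratic, `p` odd and split (`v ≠ v̄` above `p`, `ι : ℚ̄_p ≃ ℂ` normalised by the frames'
clause `hι`), a generator pair `(κ₁, κ₂; γ₁, γ₂)`, a frame `G` (`IsKatzMeasure₂ … λ …`) with `λ` of type
`(−a, 0)`, `a > 0`, unramified off `S`, and `Ψ` of type `(w, 0)`, `w > 0`, unramified everywhere: there
are a `ℤ_p`-quotient `κ` with `ker κ₁ ∩ ker κ₂ ≤ ker κ` and `I_𝔓 ≤ ker κ` for all `𝔓 ∣ v̄`, a topological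
generator `γ` of `κ`, `M > 0`, and `u ∈ ℂ_p` with `u ≠ 1` and `‖u − 1‖ < ‖p‖`, such that for every `n`
and every entire continuation `hL` of `L(λΨ^{−Mn}, s)` the ONE-VARIABLE branch
`monomialLine (κγ₁) (κγ₂) G` has the value
`ι⁻¹(interpolationValue p v v̄ S (λΨ^{−Mn}) (a + wMn) 0 Ω δ (hL 0)) · Ω_p^{a + wMn}` at `T = uⁿ − 1`.
Proof: the lead's supply `e ∘ χⁿ` (avatars of `Ψ^{−M₀ n}` through the pair), a power `N` putting all
values of `χ^N` in the one-units of level `|p|`, `M = M₀N`; saturation of the split-prime line puts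
`e ∘ χ^{Nn}` through `κ`, so its values at `γ₁, γ₂` are `(1+ (uⁿ−1))^{κγᵢ}` (`avatarValueAt_eq_onePlusPow`)
and the frame's two-variable value is a value of the branch (`hasValueAt_monomialLine_iff`). -/
theorem exists_splitPrimeLine_powerLine (ι : PadicAlgCl p ≃+* ℂ) (hK : IsImaginaryQuadratic K)
    (hp2 : p ≠ 2) {v vbar : HeightOneSpectrum (𝓞 K)} (hpv : ((p : ℕ) : 𝓞 K) ∈ v.asIdeal)
    (hpvbar : ((p : ℕ) : 𝓞 K) ∈ vbar.asIdeal) (hne : vbar ≠ v)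
    (hι : ∀ (w : InfinitePlace K) (d : 𝓞 K), d ∈ v.asIdeal ↔ ‖ι.symm (w.embedding (d : K))‖ < 1)
    {S : Finset (HeightOneSpectrum (𝓞 K))} {κ₁ κ₂ : ZpExtension K p} {γ₁ γ₂ : absoluteGaloisGroup K}
    (hpair : ZpExtension.IsTopGeneratorPair κ₁ κ₂ γ₁ γ₂)
    {lam : HeckeCharacter K} {Ω δ : ℂ} {Ωp : ℂ_[p]} {G : PowerSeries (PowerSeries (PadicComplexInt p))}
    (hG : IsKatzMeasure₂ ι v vbar S κ₁ κ₂ γ₁ γ₂ lam Ω δ Ωp G)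
    {a : ℕ} (ha : 0 < a) (hlam : lam.HasInfinityType (fun _ ↦ -(a : ℤ)) (fun _ ↦ 0))
    (hlamS : ∀ w : HeightOneSpectrum (𝓞 K), w ∉ S → lam.IsUnramifiedAt w)
    {Ψ : HeckeCharacter K} {w : ℕ} (hw : 0 < w) (hΨt : Ψ.HasInfinityType (fun _ ↦ (w : ℤ)) (fun _ ↦ 0))
    (hΨu : ∀ u : HeightOneSpectrum (𝓞 K), Ψ.IsUnramifiedAt u) :
    ∃ (κ : ZpExtension K p) (γ : absoluteGaloisGroup K) (M : ℕ) (u : ℂ_[p]),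
      ZpExtension.pairKer κ₁ κ₂ ≤ κ.kerSubgroup ∧
      (∀ 𝔓 ∈ vbar.primesAbove, 𝔓.inertia (absoluteGaloisGroup K) ≤ κ.kerSubgroup) ∧
      κ.IsTopGenerator γ ∧ 0 < M ∧ u ≠ 1 ∧ ‖u - 1‖ < ‖(p : ℂ_[p])‖ ∧
      ∀ (n : ℕ) (hL : LFunction.HasEntireContinuation (heckeLFunction (lam * Ψ⁻¹ ^ (M * n)))),
        IntSeries.HasValueAt
          (IntSeries.monomialLine (Multiplicative.toAdd (κ γ₁)) (Multiplicative.toAdd (κ γ₂)) G)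
          (u ^ n - 1)
          (((ι.symm (DeShalit1987.interpolationValue p v vbar S (lam * Ψ⁻¹ ^ (M * n))
              (a + w * (M * n)) 0 Ω δ (hL.continuation 0)) : PadicAlgCl p) : ℂ_[p]) *
            Ωp ^ (a + w * (M * n))) := by
  classical
  have hp : p.Prime := Fact.out
  haveI : IsTotallyComplex K := hK.2
  have himag : ∀ w : InfinitePlace K, w.IsComplex := fun w ↦ hK.2.isComplex w
  set e := (FramedRep.unitsContinuousMulEquivOfUnique (Fin 1) (PadicAlgCl p) :
    (PadicAlgCl p)ˣ →ₜ* GL (Fin 1) (PadicAlgCl p)) with he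
  -- the lead's supply: avatars `e ∘ χⁿ` of `Ψ^{-M₀ n}` through the pair
  have hΨ'a : Ψ⁻¹.IsAlgebraic :=
    (HeckeCharacter.isAlgebraic_iff_exists_hasInfinityType _).mpr ⟨_, _, hΨt.inv⟩
  have hΨ'u : ∀ u : HeightOneSpectrum (𝓞 K), ((p : ℕ) : 𝓞 K) ∉ u.asIdeal → Ψ⁻¹.IsUnramifiedAt u :=
    fun u _ ↦ (hΨu u).inv'
  obtain ⟨M₀, χ, hM₀, hall⟩ :=
    exists_isPAdicAvatarOf_pow_factorsThroughPair ι hK.1 himag hΨ'a hΨ'u hpair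
  -- a power `N` with all values in the one-units of level `|p|`
  obtain ⟨N, hN, hsmallN⟩ := exists_pow_norm_sub_one_lt_norm (p := p) χ
  have hall' : ∀ n : ℕ, IsPAdicAvatarOf ι (Ψ⁻¹ ^ (M₀ * N * n)) (e.comp (χ ^ (N * n))) ∧
      FactorsThroughPair κ₁ κ₂ (e.comp (χ ^ (N * n))) := fun n ↦ by
    have h := hall (N * n); rwa [← mul_assoc] at h
  -- values of `e ∘ χ^{Nn}` are one-units of level `|p|`
  have hnorm1 : ∀ g : absoluteGaloisGroup K, ‖((χ g : (PadicAlgCl p)ˣ) : PadicAlgCl p)‖ = 1 :=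
    fun g ↦ norm_apply_eq_one_of_compactSpace χ g
  have hval : ∀ (n : ℕ) (σ : absoluteGaloisGroup K), avatarValueAt (e.comp (χ ^ (N * n))) σ =
      (((((χ σ : (PadicAlgCl p)ˣ) : PadicAlgCl p) ^ N) ^ n : PadicAlgCl p) : ℂ_[p]) := by
    intro n σ
    rw [he, avatarValueAt_unitsChar, ContinuousMonoidHom.pow_apply, Units.val_pow_eq_pow_val, pow_mul]
  have hsmall : ∀ (n : ℕ) (σ : absoluteGaloisGroup K),
      ‖avatarValueAt (e.comp (χ ^ (N * n))) σ - 1‖ < ‖(p : ℂ_[p])‖ := by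
    intro n σ
    set y : PadicAlgCl p := ((χ σ : (PadicAlgCl p)ˣ) : PadicAlgCl p) ^ N with hy
    have hy1 : ‖y‖ ≤ 1 := by rw [hy, norm_pow, hnorm1, one_pow]
    have e1 : avatarValueAt (e.comp (χ ^ (N * n))) σ - 1 = ((y ^ n - 1 : PadicAlgCl p) : ℂ_[p]) := by
      rw [hval, ← hy, PadicComplex.coe_eq, PadicComplex.coe_eq, map_sub, map_one]
    rw [e1, PadicComplex.norm_extends p, ← PadicComplex.coe_natCast p p, PadicComplex.norm_extends p]
    exact (PadicAlgCl.norm_pow_sub_one_le hy1 n).trans_lt (hsmallN σ)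
  -- the saturated split-prime line carries every `e ∘ χ^{Nn}`
  obtain ⟨κ, hκpair, hκinert, hsat⟩ :=
    exists_splitPrimeLine_factorsThroughZp hK hp2 ι hpv hpvbar hne hι hpair
  have htypeΨ : ∀ m : ℕ, (Ψ⁻¹ ^ m).HasInfinityType (fun _ ↦ -((w * m : ℕ) : ℤ)) (fun _ ↦ (0 : ℤ)) := by
    intro m
    have h1 := (hΨt.inv).zpow' (m : ℤ)
    rw [zpow_natCast] at h1
    convert h1 using 2 <;> simp only [Pi.smul_apply, Pi.neg_apply, smul_eq_mul] <;> push_cast <;> ring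
  have hunrΨ : ∀ (m : ℕ) (u : HeightOneSpectrum (𝓞 K)), (Ψ⁻¹ ^ m).IsUnramifiedAt u :=
    fun m u ↦ isUnramifiedAt_pow' ((hΨu u).inv') _
  have hfacZp : ∀ n : ℕ, FactorsThroughZp κ (e.comp (χ ^ (N * n))) := fun n ↦
    hsat (Ψ⁻¹ ^ (M₀ * N * n)) _ ∅ _ (htypeΨ _) (fun u _ ↦ hunrΨ _ u) (hunrΨ _ vbar) (hall' n).1
      (hall' n).2 (hsmall n)
  -- a generator of `κ` and the node base `u = χ(γ)^N`
  obtain ⟨γ, hγ⟩ := κ.surjective (Multiplicative.ofAdd 1)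
  have hγ' : κ.IsTopGenerator γ := hγ
  set u : ℂ_[p] := avatarValueAt (e.comp (χ ^ (N * 1))) γ with hu_def
  have hun : ∀ n : ℕ, avatarValueAt (e.comp (χ ^ (N * n))) γ = u ^ n := fun n ↦ by
    rw [hu_def, hval, hval, pow_one, PadicComplex.coe_eq, PadicComplex.coe_eq, map_pow]
  refine ⟨κ, γ, M₀ * N, u, hκpair, hκinert, hγ', Nat.mul_pos hM₀ hN, fun hu1 ↦ ?_,
    hsmall 1 γ, fun n hL ↦ ?_⟩
  · -- `u = 1` would make `χ^N` trivial, hence `Ψ^{-M₀N} = 1`, contradicting its type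
    have h1 : ∀ σ : absoluteGaloisGroup K, avatarValueAt (e.comp (χ ^ (N * 1))) σ = 1 := fun σ ↦ by
      rw [ZpExtension.avatarValueAt_eq_onePlusPow (hfacZp 1) hγ' σ, ← hu_def, hu1, sub_self,
        onePlusPow_zero]
    have hχ1 : χ ^ (N * 1) = 1 := by
      ext σ
      rw [unitsChar_apply_eq_one_of_avatarValueAt_eq_one (h1 σ)]; rfl
    have hav1 : IsPAdicAvatarOf ι (Ψ⁻¹ ^ (M₀ * N * 1)) (e.comp 1) := by
      rw [← hχ1]; exact (hall' 1).1
    have heq : Ψ⁻¹ ^ (M₀ * N * 1) = 1 :=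
      eq_of_isPAdicAvatarOf_of_isPAdicAvatarOf ι hav1 (isPAdicAvatarOf_one ι)
        (fun u _ ↦ hunrΨ _ u) (fun u _ ↦ isUnramifiedAt_one' u)
    have htyp1 := htypeΨ (M₀ * N * 1)
    rw [heq] at htyp1
    have hne0 : -((w * (M₀ * N * 1) : ℕ) : ℤ) ≠ 0 := by
      have : 0 < w * (M₀ * N * 1) := Nat.mul_pos hw (by rw [mul_one]; exact Nat.mul_pos hM₀ hN)
      omega
    exact not_hasInfinityType_one_zero_of_ne_zero hne0 htyp1
  · -- the frame's value at `(r(γ₁) − 1, r(γ₂) − 1)` is a value of the branch at `uⁿ − 1`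
    have htype : (lam * Ψ⁻¹ ^ (M₀ * N * n)).HasInfinityType (fun _ ↦ -((a + w * (M₀ * N * n) : ℕ) : ℤ))
        (fun _ ↦ ((0 : ℕ) : ℤ)) := by
      have h2 := hlam.mul' (htypeΨ (M₀ * N * n))
      convert h2 using 2
      · simp only [Pi.add_apply]; push_cast; ring
      · simp only [Pi.add_apply]; push_cast
    have hunr : ∀ x : HeightOneSpectrum (𝓞 K), x ∉ S → x ≠ vbar →
        (lam * Ψ⁻¹ ^ (M₀ * N * n)).IsUnramifiedAt x := fun x hx _ ↦ (hlamS x hx).mul' (hunrΨ _ x)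
    have hjm : 0 < a + w * (M₀ * N * n) := by omega
    have h := hG.hasValueAt₂ (hall' n).1 (hall' n).2 hjm htype hunr hL
    rw [ZpExtension.avatarValueAt_eq_onePlusPow (hfacZp n) hγ' γ₁,
      ZpExtension.avatarValueAt_eq_onePlusPow (hfacZp n) hγ' γ₂, hun n, add_zero] at h
    have hx : ‖u ^ n - 1‖ < 1 := by
      have h3 := hsmall n γ
      rw [hun n] at h3
      refine h3.trans_le ?_
      rw [← PadicComplex.coe_natCast p p, PadicComplex.norm_extends p]
      exact PadicAlgCl.norm_natCast_self_lt_one.le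
    exact (IntSeries.hasValueAt_monomialLine_iff _ _ G hx _).mpr h

end Summit.BirchSwinnertonDyer.BirchSwinnertonDyer.Theorems.CycTangentCMCycTangentBoundSplitPrimePowerLine
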